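import Summits.BirchSwinnertonDyer.BirchSwinnertonDyer.Theses.ShaPrimaryTransfer
import Literature.NumberTheory.EllipticCurves.KubertTateFiveMuDescentGaussianBox
import Literature.NumberTheory.EllipticCurves.BSDSelmerParityDokchitserBaseChangeProofs
import Literature.NumberTheory.EllipticCurves.LeadingTermProofs
import Literature.NumberTheory.EllipticCurves.SelmerCorankHolds
import Literature.NumberTheory.EllipticCurves.QuadraticTwist
import Literature.NumberTheory.NumberFields.CyclotomicFieldFourClassNumber
import HarnessLib

/-!
# BirchSwinnertonDyer / ShaPrimaryTransfer — crux `FiniteShaComponentTransfer` (stmt-BirchSwinnertonDyer-22356):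
# THE DOOR AT 5 ON THE QUADRATIC TWISTS BY `-4` (`≅ -1`) OF THE KUBERT–TATE CURVES, from a full `5`-descent box
# over `ℚ(i)`

Helper file of prover seat `bsd-line-spt-p1` g20 (`--supports stmt-22356 --as helper`). THEOREMS ONLY (no definition,
no named fact, no `sorry`). The tree now contains the COMPLETE `5`-isogeny descent of `E_{m,n} = [n-m, -mn, -mn², 0, 0]`
over the Gaussian field `K = ℚ(i) = ℚ(ζ₄)` (`Literature/…/KubertTateFiveSelmerTameGaussian`: `Sel^φ(E/ℚ(i)) = 0` in the
Gaussian tame régime; `…/KubertTateFiveMuDescentNumberField(Valuation)`: `#Sel^{φ̂}(E'/ℚ(i)) ≤ 5 ^ #S`;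
`…/KubertTateFiveMuDescentGaussianBox`: `t₅(E_{m,n}/ℚ(i)) = 0` when the `ℚ(i)`-points fill the box). This file reads
it in the route's currency over `ℚ`, through the splitting `t_p(E_K) = t_p(E) + t_p(E^{(d_K)})` (g14's
`ShaPrimaryTransferBaseChange`, re-derived here at `K = ℚ(i)`, `d_{ℚ(i)} = -4`, from the three Literature facts so as
not to import a route-cone module):

* §1 `shaCorank_five_eq_zero_and_twist_of_gaussianBox` — **a full `ℚ(i)`-box gives `t₅(E_{m,n}) = 0` AND
  `t₅(E_{m,n}^{(-4)}) = 0`**: the door at `5` opens on the quadratic twist `E_{m,n}^{(-4)}` — a curve WITHOUT a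
  rational `5`-torsion point, outside the `ℚ`-isogeny classes of the Kubert–Tate curves where the earlier doors at `5`
  (g16–g19) live;
* §2 route readings: `oneFiniteShaComponent_twist_of_gaussianBox` (O for the twist, witness `p₀ = 5`),
  `transfer_twist_of_gaussianBox` (**T BY NAME** at `p₀ = 5` on the twist: `FiniteShaComponentTransfer →
  ∀ q, t_q(E_{m,n}^{(-4)}) = 0`), `forall_shaCorank_eq_zero_of_transfer_of_gaussianBox` (T ⟹ every door of `E_{m,n}`,
  `E_{m,n}^{(-4)}`, `E_{m,n} ⊗ ℚ(i)`); §0 `shaCorank_baseChange_four_eq_zero_iff` (the splitting at `K = ℚ(i)`).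

The hypotheses are those of the box theorem verbatim (`m, n ∈ ℤ`; a `Γ_{ℚ(i)}`-fixed `P₁ ∈ E(\overline{ℚ(i)})` with
`25 P₁ ≠ O`; a finite set `S` of places of `ℚ(i)` off which `m, n` are units; `5 ∤ Δ`; Gaussian tameness of the bad
primes; `5 ^ #S ≤ #(E(ℚ(i))/5E(ℚ(i)))`) — an INSTANCE is one curve's worth of explicit `ℚ(i)`-points (successor work;
recipe in the item's evidence `MU5-GAUSSIAN-g20.md`). T is UNCHANGED (conjecture-grade at analytic rank ≥ 2) and BSD is
NOT proved by any of this.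

## References

* [SilvermanAEC2009] J. H. Silverman, *AEC*, 2nd ed., Thm. X.4.2, Prop. X.4.9, Exercise 10.16.
* [Fisher2001FiveSevenDescent] T. Fisher, JEMS 3 (2001), §§1–2.
* [Dokchitser2013ParityNotes] T. Dokchitser, Notes on the parity conjecture (2013), §4.
-/

-- D-0017: single-problem summit, so `Summit.BirchSwinnertonDyer.BirchSwinnertonDyer.…` repeats a namespace BY DESIGN.
set_option linter.dupNamespace false
set_option autoImplicit false

noncomputable section

open scoped Classical
open scoped AddSubgroup
open Literature.NumberTheory.EllipticCurves Literature.NumberTheory.EllipticCurves.KubertTateVelu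
  Literature.NumberTheory.EllipticCurves.KubertTateMuDescentNF Literature.NumberTheory.NumberFields WeierstrassCurve
  NumberField IsDedekindDomain
open Summit.BirchSwinnertonDyer.BirchSwinnertonDyer.Theses.ShaPrimaryTransfer

namespace Summit.BirchSwinnertonDyer.BirchSwinnertonDyer.Theorems.ShaPrimaryTransferGaussianTwistDoor

variable {K : Type} [Field K] [NumberField K] [IsCyclotomicExtension {4} ℚ K]

omit [IsCyclotomicExtension {4} ℚ K] in
/-- Transport of `t_p` along an equality of Weierstrass curves (instances are propositions). [folklore] -/
private theorem shaCorank_congr {V V' : WeierstrassCurve K} [V.IsElliptic] [V'.IsElliptic]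
    (e : V = V') (p : ℕ) [Fact p.Prime] : V.shaCorank p = V'.shaCorank p := by
  subst e; rfl

/-- `[ℚ(ζ₄) : ℚ] = φ(4) = 2`. [folklore] -/
private theorem finrank_rat_four : Module.finrank ℚ K = 2 := by
  rw [IsCyclotomicExtension.finrank (n := 4) K (Polynomial.cyclotomic.irreducible_rat (by norm_num)),
    show Nat.totient 4 = 2 by decide]

/-- **`t_p(E_{ℚ(i)}) = 0 ⟺ t_p(E) = 0 ∧ t_p(E^{(-4)}) = 0`** for every elliptic `E/ℚ` and prime `p`: the base change to
the Gaussian field splits the corank of `Ш` into the curve and its twist by `d_{ℚ(i)} = -4` (subtract the tree facts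
`rank E(K) = rank E + rank E^{(d_K)}` and `corank Sel = rank + corank Ш` from `corank Sel(E_K) = corank Sel(E) +
corank Sel(E^{(d_K)})`; this is g14's `ShaPrimaryTransferBaseChange.shaCorank_baseChange_eq_zero_iff` restated at
`K = ℚ(i)` without importing that route-cone module). [cite: Dokchitser2013ParityNotes, §4]
[cite: SilvermanAEC2009, Exercise 10.16] -/
theorem shaCorank_baseChange_four_eq_zero_iff (W : WeierstrassCurve ℚ) [W.IsElliptic] (p : ℕ) [Fact p.Prime] :
    (W.baseChange K).shaCorank p = 0 ↔ W.shaCorank p = 0 ∧ (W.quadraticTwist (-4)).shaCorank p = 0 := by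
  haveI : (W.baseChange K).IsElliptic := by rw [WeierstrassCurve.baseChange]; infer_instance
  have hd : ((NumberField.discr K : ℤ) : ℚ) ≠ 0 := by exact_mod_cast NumberField.discr_ne_zero K
  haveI : (W.quadraticTwist (NumberField.discr K : ℚ)).IsElliptic := W.isElliptic_quadraticTwist hd
  have hS := selmerCorank_baseChange_quadratic_holds W K finrank_rat_four p
  have hR := mordellWeilRank_baseChange_quadratic_holds W K finrank_rat_four
  have hK := (W.baseChange K).selmerCorank_eq_mordellWeilRank_add_holds p
  have hQ := W.selmerCorank_eq_mordellWeilRank_add_holds p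
  have hT := (W.quadraticTwist (NumberField.discr K : ℚ)).selmerCorank_eq_mordellWeilRank_add_holds p
  have h4 : ((NumberField.discr K : ℤ) : ℚ) = -4 := by rw [discr_of_isCyclotomicExtension_four K]; norm_num
  rw [h4] at hS hR hT
  omega

variable (m n : ℤ) [hEQ : (kubertTateFive (m : ℚ) (n : ℚ)).IsElliptic] [hE : (kubertTateFive (m : K) (n : K)).IsElliptic]
variable (P₁ : geomPoints (kubertTateFive (m : K) (n : K)))
  (hP₁ : ∀ σ : Field.absoluteGaloisGroup K, σ • P₁ = P₁) (h25 : ((25 : ℕ) : ℤ) • P₁ ≠ 0)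
variable (S : Finset (HeightOneSpectrum (𝓞 K)))
  (hS : ∀ v : HeightOneSpectrum (𝓞 K), v ∉ S → ((m : ℤ) : 𝓞 K) ∉ v.asIdeal ∧ ((n : ℤ) : 𝓞 K) ∉ v.asIdeal)
  (h5 : ¬ (5 : ℤ) ∣ (kubertTateFive m n).Δ)
  (hbad : ∀ ℓ : ℕ, ℓ.Prime → (ℓ : ℤ) ∣ (kubertTateFive m n).Δ → ℓ % 5 ≠ 1 ∧ (ℓ % 5 = 4 → ℓ % 4 = 1))
  (hbox : 5 ^ S.card ≤
    Nat.card ((kubertTateFive (m : K) (n : K)).toAffine.Point ⧸ (nsmulAddMonoidHom (5 : ℕ) :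
      (kubertTateFive (m : K) (n : K)).toAffine.Point →+ (kubertTateFive (m : K) (n : K)).toAffine.Point).range))

/-! ## §0 Transport: `E_{m,n} ⊗_ℚ ℚ(i) = E_{m,n}/ℚ(i)` and `[ℚ(i) : ℚ] = 2`, `d_{ℚ(i)} = -4` -/

omit [IsCyclotomicExtension {4} ℚ K] hEQ hE in
/-- `E_{m,n} ⊗_ℚ K = E_{m,n}/K` (the family is defined over `ℤ`). [cite: Kubert1976, Table 3 (N = 5)] -/
theorem baseChange_kubertTateFive_eq :
    (kubertTateFive (m : ℚ) (n : ℚ)).baseChange K = kubertTateFive (m : K) (n : K) :=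
  KubertTateMuDescentNF.baseChange_eq (K := ℚ) m n K

/-! ## §1 The door at `5` on `E_{m,n}` and on its twist `E_{m,n}^{(-4)}` from a full `ℚ(i)`-box -/

include hP₁ h25 hS h5 hbad hbox in
/-- **A full `5`-descent box over `ℚ(i)` gives `t₅(E_{m,n}/ℚ) = 0` AND `t₅(E_{m,n}^{(-4)}/ℚ) = 0`** — the door at `5`
on the quadratic twist of the Kubert–Tate curve by `d_{ℚ(i)} = -4` (`≅` the twist by `-1`), a curve without a rational
`5`-torsion point: `t₅(E_{m,n} ⊗ ℚ(i)) = 0` (tree `KubertTateMuDescentNF.shaCorank_five_eq_zero_of_le`) and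
`t₅(E_K) = t₅(E) + t₅(E^{(d_K)})` (`shaCorank_baseChange_four_eq_zero_iff`). [cite: SilvermanAEC2009, Thm. X.4.2 and
Exercise 10.16] [cite: Fisher2001FiveSevenDescent, §2] [cite: Dokchitser2013ParityNotes, §4] -/
theorem shaCorank_five_eq_zero_and_twist_of_gaussianBox :
    (kubertTateFive (m : ℚ) (n : ℚ)).shaCorank 5 = 0 ∧
      ((kubertTateFive (m : ℚ) (n : ℚ)).quadraticTwist (-4)).shaCorank 5 = 0 := by
  haveI : Fact (Nat.Prime 5) := ⟨Nat.prime_five⟩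
  haveI hEbc : ((kubertTateFive (m : ℚ) (n : ℚ)).baseChange K).IsElliptic := by
    rw [baseChange_kubertTateFive_eq]; exact hE
  have hK0 : ((kubertTateFive (m : ℚ) (n : ℚ)).baseChange K).shaCorank 5 = 0 := by
    rw [shaCorank_congr (baseChange_kubertTateFive_eq (K := K) m n) 5]
    exact KubertTateMuDescentNF.shaCorank_five_eq_zero_of_le m n P₁ hP₁ h25 S hS h5 hbad hbox
  exact (shaCorank_baseChange_four_eq_zero_iff (K := K) (kubertTateFive (m : ℚ) (n : ℚ)) 5).mp hK0

include hP₁ h25 hS h5 hbad hbox in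
/-- The twist alone: **`t₅(E_{m,n}^{(-4)}/ℚ) = 0`** from a full `ℚ(i)`-box. [cite: SilvermanAEC2009, Thm. X.4.2 and Exercise 10.16] -/
theorem shaCorank_five_twist_eq_zero_of_gaussianBox :
    ((kubertTateFive (m : ℚ) (n : ℚ)).quadraticTwist (-4)).shaCorank 5 = 0 :=
  (shaCorank_five_eq_zero_and_twist_of_gaussianBox m n P₁ hP₁ h25 S hS h5 hbad hbox).2

/-! ## §2 Route readings: O and T by name on the twist -/

include hP₁ h25 hS h5 hbad hbox in
/-- **O for the twist, witness `p₀ = 5`**: `E_{m,n}^{(-4)}` has a prime at which the corank of `Ш` vanishes (the route's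
`OneFiniteShaComponent` shape for this curve, unconditionally given the box). [cite: SilvermanAEC2009, Thm. X.4.2] -/
theorem oneFiniteShaComponent_twist_of_gaussianBox
    [((kubertTateFive (m : ℚ) (n : ℚ)).quadraticTwist (-4)).IsElliptic] :
    ∃ (p : ℕ) (_ : Fact p.Prime), ((kubertTateFive (m : ℚ) (n : ℚ)).quadraticTwist (-4)).shaCorank p = 0 :=
  ⟨5, ⟨Nat.prime_five⟩, shaCorank_five_twist_eq_zero_of_gaussianBox m n P₁ hP₁ h25 S hS h5 hbad hbox⟩

include hP₁ h25 hS h5 hbad hbox in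
/-- **T BY NAME at `p₀ = 5` on the twist**: granting `FiniteShaComponentTransfer`, every primary component of
`Ш(E_{m,n}^{(-4)}/ℚ)` has corank `0` — the instance of T's load-bearing slice (admissible door `5`, curve without
rational `5`-torsion) that a full `ℚ(i)`-box feeds. T itself is NOT proved. [cite: SilvermanAEC2009, Thm. X.4.2] -/
theorem transfer_twist_of_gaussianBox [((kubertTateFive (m : ℚ) (n : ℚ)).quadraticTwist (-4)).IsElliptic]
    (hT : FiniteShaComponentTransfer) (q : ℕ) [Fact q.Prime] :
    ((kubertTateFive (m : ℚ) (n : ℚ)).quadraticTwist (-4)).shaCorank q = 0 :=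
  haveI : Fact (Nat.Prime 5) := ⟨Nat.prime_five⟩
  hT _ 5 q (shaCorank_five_twist_eq_zero_of_gaussianBox m n P₁ hP₁ h25 S hS h5 hbad hbox)

include hP₁ h25 hS h5 hbad hbox in
/-- **Granting T, a full `ℚ(i)`-box closes every door of `E_{m,n}`, of `E_{m,n}^{(-4)}` and of `E_{m,n} ⊗ ℚ(i)`**
(T moves the two doors at `5` over `ℚ` to `q`; the splitting reassembles them over `ℚ(i)`).
[cite: Dokchitser2013ParityNotes, §4] -/
theorem forall_shaCorank_eq_zero_of_transfer_of_gaussianBox [((kubertTateFive (m : ℚ) (n : ℚ)).quadraticTwist (-4)).IsElliptic]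
    (hT : FiniteShaComponentTransfer) (q : ℕ) [Fact q.Prime] :
    (kubertTateFive (m : ℚ) (n : ℚ)).shaCorank q = 0 ∧
      ((kubertTateFive (m : ℚ) (n : ℚ)).quadraticTwist (-4)).shaCorank q = 0 ∧
        ((kubertTateFive (m : ℚ) (n : ℚ)).baseChange K).shaCorank q = 0 := by
  haveI : Fact (Nat.Prime 5) := ⟨Nat.prime_five⟩
  haveI hEbc : ((kubertTateFive (m : ℚ) (n : ℚ)).baseChange K).IsElliptic := by
    rw [baseChange_kubertTateFive_eq]; exact hE
  obtain ⟨h1, h2⟩ := shaCorank_five_eq_zero_and_twist_of_gaussianBox m n P₁ hP₁ h25 S hS h5 hbad hbox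
  have hq1 := hT _ 5 q h1
  have hq2 := hT _ 5 q h2
  exact ⟨hq1, hq2, (shaCorank_baseChange_four_eq_zero_iff (K := K) (kubertTateFive (m : ℚ) (n : ℚ)) q).mpr ⟨hq1, hq2⟩⟩

end Summit.BirchSwinnertonDyer.BirchSwinnertonDyer.Theorems.ShaPrimaryTransferGaussianTwistDoor

end
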